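import Summits.ABC.IUTFork.Cor312ThetaSideEqualM
import Summits.ABC.IUTFork.Cor312ThetaSideExactAssemblyM
import HarnessLib

/-!
# [IUTchIII] Corollary 3.12 at the M-LEVEL sharp setting of the datum's OWN Θ-ideles — `−|log(Θ)| = ↑(−|log(Θ)|^non of the input)`,
# UNCONDITIONALLY: the nonarchimedean EQUALITY behind the READ binder `hΘ` (the «(or =)» of the mint's TARGET #2, answered)

PROOF-ONLY file (D-0012; no definitions, no `Prop` facts) of the abc-iut cell (R2 S-chain seat abc-iut-s2-p9, gen 0; branch C
«abc ⇐ S»). TAKES NO SIDE on [IUTchIII] Cor. 3.12. COMPOSITION BY NAME of abc-iut-s2-p8's exact assembly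
(`Cor312ThetaSideExactAssemblyM`, p449000: `negLogTheta = ↑negLogThetaNonarch` CONDITIONAL on the per-packet equality (hA=)) with this
seat's per-packet equality (`Cor312ThetaSideEqualM`, p448956: `thetaLocal_{i+1,u} = orbitSumM D r i u`, from the factorwise orbit span
`Literature.IUT.LogVolume.TensorPacketFactorwiseOrbitSpan` and the generic reverse inequality `Cor312ThetaLocalGeContentHull`): the binder (hA=)
DISCHARGED, so

* **`negLogTheta_settingMSharp_tOfIdeleData_eq_negLogThetaNonarch`** (frames route), `negLogTheta_settingPrVolSharpM_tOfIdeleData_eq_…`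
  (summand route), `negLogTheta_settingMSharp_eq_negLogThetaNonarch_of_isVolumeInputOf` (for every volume input of `D`);
* **`negLogTheta_volumeInputOf_eq_settingMSharp_add_archLogTheta`** — `↑I.negLogTheta = −|log(Θ)|(setting) + ↑(((l+5)/4)·log π)`: the READ
  binder `hΘ` (`≤`, abc-iut-s2-p8 p440655) is slack by EXACTLY the archimedean summand of abc-iut-S2's number (the setting's archimedean
  container is trivial); on the nonarchimedean side print's factorwise (Ind2) and Dupuy–Hilado's full lattice group agree to the digit.

[cite: Mochizuki2012, IUTchIII Cor. 3.12 p. 173–174] [cite: Mochizuki2012, IUTchIV Thm. 1.10 Steps (v)–(viii) p. 27–31]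
[cite: DupuyHilado2025, §4.9, §4.12] [claim: Mochizuki2012, status: disputed] for the quoted setting.
HONEST FRAMING: identities between TYPED objects; nothing asserted or denied about Cor. 3.12; typed ≠ proved; instantiated ≠ endorsed.
-/

noncomputable section

open Set Function NumberField IsDedekindDomain
open scoped Pointwise

namespace Summit.ABC.IUTFork.Thm311.Real

open Cor312 Cor312Vol Literature.IUT.LogThetaLattice Literature.IUT.LogVolume Literature.IUT.HodgeTheaters
  Literature.NumberTheory.NumberFields

variable {F K Fbar : Type} [Field F] [NumberField F] [Field K] [NumberField K] [Algebra F K]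
  [Field Fbar] [Algebra F Fbar] [Algebra K Fbar] {E : WeierstrassCurve F} [E.IsElliptic] {l : ℕ}
  {Pb : BadPlacePredicates K} (D : InitialThetaData F K Fbar E l Pb) {logvK : PadicLogsVal K}
  (hlog : LogvAnalyticVal logvK) (r : ThetaData.IdeleData D)
  (tq : ∀ (u : FinitePlace ℚ) (x : (thetaIndexOfInitial D).Fibre (Val.non u)),
    kOfM D (ratChar u) u (natCast_ratChar_mem u) x)
  (M : Type) [Field M] [NumberField M]
  (archPk : ∀ (j : (thetaIndexOfInitial D).Label) (vQ : (thetaIndexOfInitial D).VQ),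
    Set ((logShellsOfInitialDH D logvK).Packet j vQ))
  (archSub : ∀ (j : (thetaIndexOfInitial D).Label) (v : (thetaIndexOfInitial D).V),
    Set ((logShellsOfInitialDH D logvK).Packet j ((thetaIndexOfInitial D).over v)))
  (Ψ : ℤ → ∀ v : (thetaIndexOfInitial D).V, v ∈ (thetaIndexOfInitial D).Vbad →
    Set ((logShellsOfInitialDH D logvK).StarPacket v))
  (act : ℤ → ∀ v : (thetaIndexOfInitial D).V, v ∈ (thetaIndexOfInitial D).Vbad →
    (logShellsOfInitialDH D logvK).StarPacket v → Module.End ℚ ((logShellsOfInitialDH D logvK).StarPacket v))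
  (Mmod : ℤ → ∀ j : (thetaIndexOfInitial D).LabelStar, Set ((logShellsOfInitialDH D logvK).GlobalPacket j.1))
  (region : ℤ → ∀ j : (thetaIndexOfInitial D).LabelStar, FinDivisor M → ∀ vQ : (thetaIndexOfInitial D).VQ,
    Set ((logShellsOfInitialDH D logvK).Packet j.1 vQ))
  (n : ℤ) {HT : Type} {LogLink : HT → HT → Type} {IsFull : ∀ {s t : HT}, LogLink s t → Prop}
  (lat : LGPGaussianLogThetaLattice LogLink IsFull)
  {Frd : Type} {IsoF : Frd → Frd → Type} {Ob : Frd → Type} {realify : Frd → Frd} {Strip : Type}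
  {IsoS : Strip → Strip → Type}
  {Mv : ∀ v : (thetaIndexOfInitial D).V, v ∈ (thetaIndexOfInitial D).Vbad → Type} [∀ v h, Monoid (Mv v h)]
  (sig : GlobalLGPFrobenioidSignature (thetaIndexOfInitial D).lstar (thetaIndexOfInitial D).V
    (· ∈ (thetaIndexOfInitial D).Vbad) Frd IsoF Ob realify Strip IsoS Mv)
  (split : SplittingMonoids Mv) {ObΔ : Type}
  {N : ∀ v : (thetaIndexOfInitial D).V, v ∈ (thetaIndexOfInitial D).Vbad → Type} [∀ v h, Monoid (N v h)]
  (qData : QPilotData ObΔ N)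
  (htq0 : ∀ u x, tq u x ≠ 0) (Sq : Finset (FinitePlace ℚ))
  (htq1 : ∀ (u : FinitePlace ℚ) (x : (thetaIndexOfInitial D).Fibre (Val.non u)), u ∉ Sq → ‖tq u x‖ = 1)


/-- **`−|log(Θ)| = ↑I.negLogThetaNonarch`, `I = volumeInputOf D r`, UNCONDITIONALLY** at abc-iut-w5-d166's frames-route M-level sharp
setting of the datum's own Θ-ideles (abc-iut-s2-p8's `…_of_local_eq` at this seat's `thetaLocal_settingMSharp_tOfIdeleData_eq_orbitSumM`).
[cite: Mochizuki2012, IUTchIII Cor. 3.12 p. 173–174] [cite: DupuyHilado2025, §4.9, §4.12] -/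
theorem negLogTheta_settingMSharp_tOfIdeleData_eq_negLogThetaNonarch :
    (settingMSharp D hlog M archPk archSub Ψ act Mmod region n lat sig split qData (tOfIdeleData D r) tq htq0 Sq htq1).negLogTheta =
      (((ThetaData.volumeInputOf D r).negLogThetaNonarch : ℝ) : WithTop ℝ) :=
  negLogTheta_settingMSharp_tOfIdeleData_eq_negLogThetaNonarch_of_local_eq D r hlog tq M archPk archSub Ψ act Mmod region n lat sig
    split qData htq0 Sq htq1 fun i u =>
      thetaLocal_settingMSharp_tOfIdeleData_eq_orbitSumM D hlog r tq M archPk archSub Ψ act Mmod region n lat sig split qData htq0 Sq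
        htq1 i u

/-- **… and at abc-iut-s2-p8's summand-route sharp setting `settingPrVolSharpM`.** [cite: Mochizuki2012, IUTchIII Cor. 3.12 p. 173–174] -/
theorem negLogTheta_settingPrVolSharpM_tOfIdeleData_eq_negLogThetaNonarch :
    (settingPrVolSharpM D hlog (tOfIdeleData D r) tq M archPk archSub Ψ act Mmod region n lat sig split qData htq0 Sq
        htq1).negLogTheta = (((ThetaData.volumeInputOf D r).negLogThetaNonarch : ℝ) : WithTop ℝ) :=
  negLogTheta_settingPrVolSharpM_tOfIdeleData_eq_negLogThetaNonarch_of_local_eq D r hlog tq M archPk archSub Ψ act Mmod region n lat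
    sig split qData htq0 Sq htq1 fun i u =>
      thetaLocal_settingMSharp_tOfIdeleData_eq_orbitSumM D hlog r tq M archPk archSub Ψ act Mmod region n lat sig split qData htq0 Sq
        htq1 i u

/-- **For every volume input `I` of `D`** (`IsVolumeInputOf D I`): at the frames-route M-level sharp setting of `I`'s own Θ-ideles,
`−|log(Θ)| = ↑I.negLogThetaNonarch` — the companion of the READ binder's discharge `negLogTheta_settingMSharp_le_of_isVolumeInputOf`
(abc-iut-s2-p8 p440655). [cite: Mochizuki2012, IUTchIII Cor. 3.12 p. 173–174] -/
theorem negLogTheta_settingMSharp_eq_negLogThetaNonarch_of_isVolumeInputOf {I : ThetaVolumeInput (fieldOfModuli E) K}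
    (hI : ThetaData.IsVolumeInputOf D I) :
    (settingMSharp D hlog M archPk archSub Ψ act Mmod region n lat sig split qData (tOfIdeleData D (ideleDataOf D hI)) tq htq0
        Sq htq1).negLogTheta = ((I.negLogThetaNonarch : ℝ) : WithTop ℝ) :=
  negLogTheta_settingMSharp_eq_negLogThetaNonarch_of_isVolumeInputOf_of_local_eq D hlog tq M archPk archSub Ψ act Mmod region n lat
    sig split qData htq0 Sq htq1 hI fun i u =>
      thetaLocal_settingMSharp_tOfIdeleData_eq_orbitSumM D hlog (ideleDataOf D hI) tq M archPk archSub Ψ act Mmod region n lat sig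
        split qData htq0 Sq htq1 i u

/-- **The slack of `hΘ` is EXACTLY the archimedean summand**: `↑I.negLogTheta = −|log(Θ)|(settingMSharp of I's own Θ-ideles) +
↑(((l+5)/4)·log π)` for `I = volumeInputOf D r` (abc-iut-S2 `negLogTheta = negLogThetaNonarch + archLogTheta`).
[cite: Mochizuki2012, IUTchIV Thm. 1.10 Step (viii) p. 31] -/
theorem negLogTheta_volumeInputOf_eq_settingMSharp_add_archLogTheta :
    (((ThetaData.volumeInputOf D r).negLogTheta : ℝ) : WithTop ℝ) =
      (settingMSharp D hlog M archPk archSub Ψ act Mmod region n lat sig split qData (tOfIdeleData D r) tq htq0 Sq htq1).negLogTheta +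
        ((ThetaVolumeInput.archLogTheta (ThetaData.volumeInputOf D r).l : ℝ) : WithTop ℝ) := by
  rw [negLogTheta_settingMSharp_tOfIdeleData_eq_negLogThetaNonarch, ← WithTop.coe_add]
  rfl

end Summit.ABC.IUTFork.Thm311.Real

end
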